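import Literature.Computability.AlgebraicComplexity.BorderRankMatMulLandsbergOttavianiAllFields
import Summits.MatrixMultiplication.MatrixMultiplication.Theorems.FarEdgeDescentStrassenFloor
import HarnessLib

/-!
# Far-edge descent, kernel XXXIX-E — the Landsberg–Ottaviani floor of a direct sum of matrix products

Kernels XXXIX-A…D bounded the border rank of `D = ⊕ᵢ ⟨kᵢ,mᵢ,kᵢ⟩` from below by Strassen's equation
(BCS Thm. (19.12)); the surplus of that method is at most half the `x`-count, so its ceiling is
`R̲(D) ≥ (3/2)·∑kᵢmᵢ`.  This file instantiates the tree's KOSZUL FLATTENING bound for border rank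
(`LandsbergOttaviani2015_thm21_algBorderRank`: `rank K_Φ(t) ≤ C(2p,p)·R̲(t)`, every field) on the
tree's `matMulDirectSum K k m k`, with a BLOCK PROJECTION `Φ` (`loProj`) that sends a block of width
`1` (an anchor `⟨1,Q,1⟩`) to the first basis vector `e₀` and every other block to the Landsberg–
Ottaviani Vandermonde weights `c_j^{κ+ν}` at nodes `c₀,…,c_{2p}` (the tree's
`matMulKoszulMatrix_injective_of_nodes`).  Across blocks the `z`-fibres vanish (`fibre_zero`), so a
well-chosen square submatrix of `K_Φ(D)` is block diagonal (`submatrix_koszul_eq`): the IDENTITY on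
the anchor labels (`wedge_unit`: `e₀ ∧ ·` from `Λᵖ K^{{1..2p}}` to `e₀ ∧ Λᵖ K^{{1..2p}}` — the anchor
survives the flattening at full weight `C(2p,p)·Q`) and one copy of a non-zero maximal minor of the
reduced flattening `M̃(Φ_c)` per label of a block of width `p + 1` (`C(2p+1,p+1)(p+1)` per inner
index).  Dividing by `C(2p,p)`:

* `lo_floor_of_nodes` — `∑_{kᵢ=1} mᵢ + (2p+1)·∑_{kᵢ=p+1} mᵢ ≤ R̲(⊕ᵢ ⟨kᵢ,mᵢ,kᵢ⟩)` (`p ≥ 1`) over a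
  field with `2p+1` distinct nodes;
* **`lo_floor`** — the same over EVERY field (nodes `X^j` in `K(X)`, `matMulDirectSum_map` and the
  descent `R̲_{K(X)} ≤ R̲_K`, `algBorderRank_map_le`, exactly as the tree's one-block
  `LandsbergOttaviani2015_thm_1_1_allFields`).

The anchored / multiple / budget corollaries (`β ≥ 2 − 1/a` for the anchor-budget dial) are in
`FarEdgeDescentKoszulFloorReadout`.

HONEST FRAMING: Landsberg–Ottaviani's `R̲(⟨n,l,n⟩) ≥ (2n−1)l` (in tree, every field) made ADDITIVE over
a direct sum with the width-`1` blocks retained — an instantiation of the tree's general Koszul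
theorem with a block projection, not a new lower-bound method; blocks of widths other than `1` and
`p+1` get weight `0` (mixed widths are the Strassen floors' business).  For thin blocks (`mᵢ < kᵢ`) the
trivial `z`-flattening `∑kᵢ² ≤ R̲` can be better (Schönhage's `⟨a,1,a⟩ ⊕ ⟨1,(a−1)²,1⟩`: `a² + 1` versus
`a²` here).  No upper bound on any border rank is proved; nothing here bears on `AnchoredLogConvexity`.
The definitions are a coefficient matrix (`loProj`) and index bookkeeping (`liftS`, `lift0`, `UnitIdx`,
`LOIdx`, `uz`, `rowSel`, `colSel`) only.

## References
* J. M. Landsberg, G. Ottaviani, *New lower bounds for the border rank of matrix multiplication*,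
  Theory Comput. 11 (2015) 285–298, Thm. 1.1, Thm. 2.1. [LandsbergOttaviani2015]
* J. M. Landsberg, *Geometry and Complexity Theory*, CUP 2017, §2.5.2, Thm. 2.5.2.6. [Landsberg2017]
* P. Bürgisser, M. Clausen, M. A. Shokrollahi, *Algebraic Complexity Theory*, Springer 1997,
  (15.12), Lemma (15.26). [BurgisserClausenShokrollahi1997]
-/

noncomputable section

open scoped BigOperators Polynomial
open Matrix Finset

set_option linter.dupNamespace false

namespace Summit.MatrixMultiplication.MatrixMultiplication.Theorems.FarEdgeDescentKoszulFloor

open Literature.Computability.AlgebraicComplexity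
open Summit.MatrixMultiplication.MatrixMultiplication.Theorems.FarEdgeDescentStrassenFloor

variable (K : Type) [Field K] {q : ℕ}

/-! ## §1 The `z`-fibres of the direct sum -/

/-- The `z`-fibre of `⊕ᵢ⟨kᵢ,mᵢ,kᵢ⟩` over a matching pair `x = (i;κ,μ)`, `y = (i;μ,ν)` is the basis
vector `z_{(i;κ,ν)}`. -/
theorem fibre_same (k m : Fin q → ℕ) (i : Fin q) (κ ν : Fin (k i)) (μ : Fin (m i)) :
    (fun a => matMulDirectSum K k m k a ⟨i, (κ, μ)⟩ ⟨i, (μ, ν)⟩) =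
      Pi.single (⟨i, (κ, ν)⟩ : Σ i, Fin (k i) × Fin (k i)) 1 := by
  funext a
  simp only [matMulDirectSum, Pi.single_apply, true_and]
  by_cases h : a.1 = i ∧ (a.2.1 : ℕ) = κ ∧ (a.2.2 : ℕ) = ν
  · rw [if_pos h, if_pos ((sigma_eq_iff a ⟨i, (κ, ν)⟩).2 h)]
  · rw [if_neg h, if_neg fun h' => h ((sigma_eq_iff a ⟨i, (κ, ν)⟩).1 h')]

/-- The `z`-fibre over a non-matching pair (different blocks or inner indices) vanishes. -/
theorem fibre_zero (k m : Fin q → ℕ) (x : Σ i, Fin (k i) × Fin (m i))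
    (y : Σ i, Fin (m i) × Fin (k i)) (h : ¬ (x.1 = y.1 ∧ (x.2.2 : ℕ) = y.2.1)) :
    (fun a => matMulDirectSum K k m k a x y) = 0 := by
  funext a
  simp only [matMulDirectSum, Pi.zero_apply]
  rw [if_neg]
  rintro ⟨-, h2, -, h4, -⟩
  exact h ⟨h2, h4⟩

/-- Entries are `0`/`1`, so the direct sum is preserved by every ring map (scalar extension). -/
theorem matMulDirectSum_map {L : Type} [Field L] (f : K →+* L) (k m n : Fin q → ℕ) :
    (fun a b c => f (matMulDirectSum K k m n a b c)) = matMulDirectSum L k m n := by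
  funext a b c
  simp only [matMulDirectSum, apply_ite f, map_one, map_zero]

/-! ## §2 The block projection -/

/-- The block projection `Φ : ⊕ᵢ K^{kᵢ×kᵢ} → K^{2p+1}` in matrix form: a block of width `1` goes to
`e₀`, any other block to the Vandermonde weights `c_j^{κ+ν}` (Landsberg–Ottaviani's projection in the
Lagrange basis at the nodes `c`). -/
def loProj (k : Fin q → ℕ) (p : ℕ) (c : Fin (2 * p + 1) → K) :
    Matrix (Fin (2 * p + 1)) (Σ i, Fin (k i) × Fin (k i)) K :=
  Matrix.of fun j a => if k a.1 = 1 then (Pi.single (0 : Fin (2 * p + 1)) (1 : K) : Fin (2 * p + 1) → K) j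
    else c j ^ ((a.2.1 : ℕ) + a.2.2)

/-- `Φ(z_a)` is column `a` of the projection matrix. -/
theorem loProj_single (k : Fin q → ℕ) (p : ℕ) (c : Fin (2 * p + 1) → K)
    (a : Σ i, Fin (k i) × Fin (k i)) :
    (loProj K k p c).mulVecLin (Pi.single a 1) = fun j => loProj K k p c j a := by
  ext j
  rw [Matrix.mulVecLin_apply, Matrix.mulVec_single_one]
  rfl

/-- Entry of the Koszul flattening of the direct sum over a non-matching pair: `0`. -/
theorem entry_zero (k m : Fin q → ℕ) (p : ℕ) (c : Fin (2 * p + 1) → K)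
    (T : PSub (2 * p + 1) (p + 1)) (S : PSub (2 * p + 1) p) (x : Σ i, Fin (k i) × Fin (m i))
    (y : Σ i, Fin (m i) × Fin (k i)) (h : ¬ (x.1 = y.1 ∧ (x.2.2 : ℕ) = y.2.1)) :
    koszulFlattening p (loProj K k p c).mulVecLin (matMulDirectSum K k m k) (T, y) (S, x) = 0 := by
  show wedgeMatrix ((loProj K k p c).mulVecLin fun a => matMulDirectSum K k m k a x y) T.1 S.1 = 0
  rw [fibre_zero K k m x y h, map_zero, wedgeMatrix_zero]
  rfl

/-- Entry over a matching pair `x = (i;κ,μ)`, `y = (i;μ,ν)`: `(Φ(z_{(i;κ,ν)}) ∧ e_S)_T`. -/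
theorem entry_same (k m : Fin q → ℕ) (p : ℕ) (c : Fin (2 * p + 1) → K)
    (T : PSub (2 * p + 1) (p + 1)) (S : PSub (2 * p + 1) p) (i : Fin q) (κ ν : Fin (k i))
    (μ : Fin (m i)) :
    koszulFlattening p (loProj K k p c).mulVecLin (matMulDirectSum K k m k)
        (T, ⟨i, (μ, ν)⟩) (S, ⟨i, (κ, μ)⟩) =
      wedgeMatrix (fun j => loProj K k p c j ⟨i, (κ, ν)⟩) T.1 S.1 := by
  show wedgeMatrix ((loProj K k p c).mulVecLin
    fun a => matMulDirectSum K k m k a ⟨i, (κ, μ)⟩ ⟨i, (μ, ν)⟩) T.1 S.1 = _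
  rw [fibre_same K k m i κ ν μ, loProj_single]

/-! ## §3 Index bookkeeping: the anchor blocks see `Λᵖ K^{2p}` inside `Λ K^{2p+1}` -/

variable {K}

/-- `S ⊆ {0,…,2p−1}` shifted to `S + 1 ⊆ {1,…,2p}`. -/
def liftS {p : ℕ} (S : PSub (2 * p) p) : PSub (2 * p + 1) p :=
  ⟨S.1.map (Fin.succEmb (2 * p)), by rw [Finset.card_map]; exact S.2⟩

/-- `0 ∉ S + 1`. -/
theorem zero_notMem_liftS {p : ℕ} (S : PSub (2 * p) p) :
    (0 : Fin (2 * p + 1)) ∉ (liftS S).1 := by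
  simp [liftS, Fin.succ_ne_zero]

/-- `{0} ∪ (S + 1)`, a `(p+1)`-subset of `{0,…,2p}`. -/
def lift0 {p : ℕ} (S : PSub (2 * p) p) : PSub (2 * p + 1) (p + 1) :=
  ⟨insert 0 (liftS S).1, by rw [Finset.card_insert_of_notMem (zero_notMem_liftS S), (liftS S).2]⟩

/-- Shifting is injective. -/
theorem liftS_injective {p : ℕ} : Function.Injective (liftS (p := p)) := by
  intro S S' h
  apply Subtype.ext
  have h' := congrArg Subtype.val h
  simpa [liftS, Finset.map_inj] using h'

/-- `e₀ ∧ ·` from the columns `S + 1` to the rows `{0} ∪ (S + 1)` is the identity matrix. -/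
theorem wedge_unit {p : ℕ} (S₁ S₂ : PSub (2 * p) p) :
    wedgeMatrix (Pi.single (0 : Fin (2 * p + 1)) (1 : K)) (lift0 S₁).1 (liftS S₂).1 =
      if S₁ = S₂ then 1 else 0 := by
  by_cases h : S₁ = S₂
  · subst h
    rw [if_pos rfl, show (lift0 S₁).1 = insert 0 (liftS S₁).1 from rfl,
      wedgeMatrix_insert _ (zero_notMem_liftS S₁), Pi.single_eq_same, mul_one]
    simp [koszulSign]
  · rw [if_neg h]
    apply wedgeMatrix_of_not
    rintro ⟨hsub, -⟩
    apply h
    have hsub' : (liftS S₂).1 ⊆ (liftS S₁).1 := by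
      intro s hs
      rcases Finset.mem_insert.1 (hsub hs) with rfl | h'
      · exact absurd hs (zero_notMem_liftS S₂)
      · exact h'
    have heq : (liftS S₂).1 = (liftS S₁).1 :=
      Finset.eq_of_subset_of_card_le hsub' (by rw [(liftS S₁).2, (liftS S₂).2])
    exact (liftS_injective (Subtype.ext heq)).symm

/-- Labels of the anchor rows/columns: a block of width `1` and an inner index. -/
abbrev UnitIdx (k m : Fin q → ℕ) : Type := Σ i : {i : Fin q // k i = 1}, Fin (m i.1)

/-- Labels of the Landsberg–Ottaviani rows/columns: a block of width `p + 1` and an inner index. -/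
abbrev LOIdx (k m : Fin q → ℕ) (p : ℕ) : Type := Σ i : {i : Fin q // k i = p + 1}, Fin (m i.1)

/-- Equality of labels is equality of the block and of the inner index. -/
theorem sigmaSub_eq_iff {P : Fin q → Prop} {m : Fin q → ℕ}
    (u u' : Σ i : {i : Fin q // P i}, Fin (m i.1)) :
    u = u' ↔ u.1.1 = u'.1.1 ∧ (u.2 : ℕ) = u'.2 := by
  constructor
  · rintro rfl
    exact ⟨rfl, rfl⟩
  · obtain ⟨⟨i, hi⟩, μ⟩ := u
    obtain ⟨⟨i', hi'⟩, μ'⟩ := u'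
    rintro ⟨h1, h2⟩
    simp only at h1 h2
    subst h1
    obtain rfl : μ = μ' := Fin.ext h2
    rfl

/-- The unique outer index of a block of width `1`. -/
def uz {k : Fin q → ℕ} (i : {i : Fin q // k i = 1}) : Fin (k i.1) := ⟨0, by rw [i.2]; exact Nat.one_pos⟩

/-- Row selection: anchor rows `({0} ∪ (S+1), (i;μ,0))`, LO rows `(T, (i;μ,ν))`. -/
def rowSel (k m : Fin q → ℕ) (p : ℕ) :
    (PSub (2 * p) p × UnitIdx k m) ⊕ ((PSub (2 * p + 1) (p + 1) × Fin (p + 1)) × LOIdx k m p) →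
      PSub (2 * p + 1) (p + 1) × (Σ i, Fin (m i) × Fin (k i)) :=
  Sum.elim (fun x => (lift0 x.1, ⟨x.2.1.1, (x.2.2, uz x.2.1)⟩))
    (fun x => (x.1.1, ⟨x.2.1.1, (x.2.2, Fin.cast x.2.1.2.symm x.1.2)⟩))

/-- Column selection: anchor columns `(S+1, (i;0,μ))`, LO columns `(ε(T,ν).1, (i;ε(T,ν).2,μ))`
for a column matching `ε` of the reduced flattening. -/
def colSel (k m : Fin q → ℕ) (p : ℕ)
    (ε : PSub (2 * p + 1) (p + 1) × Fin (p + 1) → PSub (2 * p + 1) p × Fin (p + 1)) :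
    (PSub (2 * p) p × UnitIdx k m) ⊕ ((PSub (2 * p + 1) (p + 1) × Fin (p + 1)) × LOIdx k m p) →
      PSub (2 * p + 1) p × (Σ i, Fin (k i) × Fin (m i)) :=
  Sum.elim (fun x => (liftS x.1, ⟨x.2.1.1, (uz x.2.1, x.2.2)⟩))
    (fun x => ((ε x.1).1, ⟨x.2.1.1, (Fin.cast x.2.1.2.symm (ε x.1).2, x.2.2)⟩))

variable (K)

/-- **The selected submatrix of the Koszul flattening of `⊕ᵢ⟨kᵢ,mᵢ,kᵢ⟩` is block diagonal**: the
identity on the anchor labels, and one copy of the `ε`-minor of the reduced Landsberg–Ottaviani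
flattening `M̃(Φ_c)` per LO label. [cite: Landsberg2017, §2.5.2, Thm. 2.5.2.6 (proof)] -/
theorem submatrix_koszul_eq (k m : Fin q → ℕ) (p : ℕ) (hp : 1 ≤ p) (c : Fin (2 * p + 1) → K)
    (ΦLO : (Fin (p + 1) × Fin (p + 1) → K) →ₗ[K] (Fin (2 * p + 1) → K))
    (hΦLO : ∀ (κ ν : Fin (p + 1)) (j : Fin (2 * p + 1)),
      ΦLO (Pi.single (κ, ν) 1) j = c j ^ ((κ : ℕ) + ν))
    (ε : PSub (2 * p + 1) (p + 1) × Fin (p + 1) → PSub (2 * p + 1) p × Fin (p + 1)) :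
    (koszulFlattening p (loProj K k p c).mulVecLin (matMulDirectSum K k m k)).submatrix
        (rowSel k m p) (colSel k m p ε) =
      Matrix.fromBlocks 1 0 0
        (Matrix.blockDiagonal fun _ : LOIdx k m p =>
          (matMulKoszulMatrix (p + 1) p ΦLO).submatrix id ε) := by
  classical
  ext (x | x) (x' | x')
  · obtain ⟨S₁, ⟨⟨i, hi⟩, μ⟩⟩ := x
    obtain ⟨S₂, ⟨⟨i', hi'⟩, μ'⟩⟩ := x'
    rw [Matrix.submatrix_apply, Matrix.fromBlocks_apply₁₁, Matrix.one_apply]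
    simp only [rowSel, colSel, Sum.elim_inl]
    by_cases h : i = i' ∧ (μ : ℕ) = μ'
    · obtain ⟨rfl, hμ⟩ := h
      obtain rfl : μ = μ' := Fin.ext hμ
      rw [entry_same]
      have hlo : (fun j => loProj K k p c j ⟨i, (uz ⟨i, hi'⟩, uz ⟨i, hi⟩)⟩) =
          Pi.single (0 : Fin (2 * p + 1)) (1 : K) := by
        funext j
        simp [loProj, hi]
      rw [hlo, wedge_unit]
      by_cases hS : S₁ = S₂
      · subst hS
        simp
      · rw [if_neg hS, if_neg fun hx => hS (congrArg Prod.fst hx)]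
    · rw [entry_zero K k m p c _ _ _ _ fun h' => h ⟨h'.1.symm, h'.2.symm⟩, if_neg]
      intro hx
      have h2 := (sigmaSub_eq_iff _ _).1 (congrArg Prod.snd hx)
      exact h ⟨h2.1, h2.2⟩
  · obtain ⟨S₁, ⟨⟨i, hi⟩, μ⟩⟩ := x
    obtain ⟨⟨T', ν'⟩, ⟨⟨i', hi'⟩, μ'⟩⟩ := x'
    rw [Matrix.submatrix_apply, Matrix.fromBlocks_apply₁₂, Matrix.zero_apply]
    simp only [rowSel, colSel, Sum.elim_inl, Sum.elim_inr]
    refine entry_zero K k m p c _ _ _ _ ?_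
    rintro ⟨h1, -⟩
    have : k i' = k i := by rw [show i' = i from h1]
    omega
  · obtain ⟨⟨T, ν⟩, ⟨⟨i, hi⟩, μ⟩⟩ := x
    obtain ⟨S₂, ⟨⟨i', hi'⟩, μ'⟩⟩ := x'
    rw [Matrix.submatrix_apply, Matrix.fromBlocks_apply₂₁, Matrix.zero_apply]
    simp only [rowSel, colSel, Sum.elim_inl, Sum.elim_inr]
    refine entry_zero K k m p c _ _ _ _ ?_
    rintro ⟨h1, -⟩
    have : k i' = k i := by rw [show i' = i from h1]
    omega
  · obtain ⟨⟨T, ν⟩, ⟨⟨i, hi⟩, μ⟩⟩ := x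
    obtain ⟨⟨T', ν'⟩, ⟨⟨i', hi'⟩, μ'⟩⟩ := x'
    rw [Matrix.submatrix_apply, Matrix.fromBlocks_apply₂₂, Matrix.blockDiagonal_apply]
    simp only [rowSel, colSel, Sum.elim_inr]
    by_cases h : i = i' ∧ (μ : ℕ) = μ'
    · obtain ⟨rfl, hμ⟩ := h
      obtain rfl : μ = μ' := Fin.ext hμ
      rw [entry_same, if_pos rfl, Matrix.submatrix_apply, id, matMulKoszulMatrix_apply]
      have hne : ¬ k i = 1 := by omega
      congr 1
      funext j
      rw [hΦLO]
      simp [loProj, hne]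
    · rw [entry_zero K k m p c _ _ _ _ fun h' => h ⟨h'.1.symm, h'.2.symm⟩, if_neg]
      intro hx
      have h2 := (sigmaSub_eq_iff _ _).1 hx
      exact h ⟨h2.1, h2.2⟩

/-! ## §4 The floor -/

/-- `|UnitIdx| = ∑_{kᵢ = 1} mᵢ`. -/
theorem card_unitIdx (k m : Fin q → ℕ) :
    Fintype.card (UnitIdx k m) = ∑ i ∈ univ.filter (fun i => k i = 1), m i := by
  rw [Fintype.card_sigma,
    Finset.sum_subtype (p := fun i => k i = 1) (F := inferInstance) (univ.filter fun i => k i = 1)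
      (fun i => by simp) m]
  simp only [Fintype.card_fin]

/-- `|LOIdx| = ∑_{kᵢ = p+1} mᵢ`. -/
theorem card_loIdx (k m : Fin q → ℕ) (p : ℕ) :
    Fintype.card (LOIdx k m p) = ∑ i ∈ univ.filter (fun i => k i = p + 1), m i := by
  rw [Fintype.card_sigma,
    Finset.sum_subtype (p := fun i => k i = p + 1) (F := inferInstance)
      (univ.filter fun i => k i = p + 1) (fun i => by simp) m]
  simp only [Fintype.card_fin]

set_option synthInstance.maxSize 512 in
/-- **The Landsberg–Ottaviani floor of a direct sum, over a field with `2p+1` distinct nodes:**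
`∑_{kᵢ=1} mᵢ + (2p+1)·∑_{kᵢ=p+1} mᵢ ≤ R̲(⊕ᵢ ⟨kᵢ,mᵢ,kᵢ⟩)` (`p ≥ 1`).
[cite: LandsbergOttaviani2015, Thm 1.1, Thm 2.1] [cite: Landsberg2017, §2.5.2, Thm. 2.5.2.6] -/
theorem lo_floor_of_nodes (k m : Fin q → ℕ) (p : ℕ) (hp : 1 ≤ p) (c : Fin (2 * p + 1) → K)
    (hc : Function.Injective c) :
    (∑ i ∈ univ.filter (fun i => k i = 1), m i) +
        (2 * p + 1) * ∑ i ∈ univ.filter (fun i => k i = p + 1), m i ≤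
      algBorderRank (matMulDirectSum K k m k) := by
  -- the Landsberg–Ottaviani projection on a block of width `p + 1`, and a non-zero maximal minor
  set ΦLO : (Fin (p + 1) × Fin (p + 1) → K) →ₗ[K] (Fin (2 * p + 1) → K) :=
    (Matrix.of fun (j : Fin (2 * p + 1)) (a : Fin (p + 1) × Fin (p + 1)) =>
      c j ^ ((a.1 : ℕ) + a.2)).mulVecLin with hΦLOdef
  have hΦLO : ∀ (κ ν : Fin (p + 1)) (j : Fin (2 * p + 1)),
      ΦLO (Pi.single (κ, ν) 1) j = c j ^ ((κ : ℕ) + ν) := by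
    intro κ ν j
    simp [hΦLOdef, Matrix.mulVec, dotProduct, Pi.single_apply]
  have hcard : Fintype.card (PSub (2 * p + 1) (p + 1) × Fin (p + 1)) =
      Fintype.card (PSub (2 * p + 1) p × Fin (p + 1)) := by
    simp only [Fintype.card_prod, card_PSub, Fintype.card_fin, Nat.choose_symm_half]
  obtain ⟨ε, hε⟩ := exists_det_submatrix_ne_zero_of_injective _ hcard
    (matMulKoszulMatrix_injective_of_nodes p c hc ΦLO hΦLO)
  -- the block-diagonal minor of the flattening of the direct sum
  set M := koszulFlattening p (loProj K k p c).mulVecLin (matMulDirectSum K k m k) with hMdef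
  have hsub := submatrix_koszul_eq K k m p hp c ΦLO hΦLO ε
  have hdet : (M.submatrix (rowSel k m p) (colSel k m p ε)).det ≠ 0 := by
    rw [hMdef, hsub, Matrix.det_fromBlocks_zero₂₁, Matrix.det_one, one_mul,
      Matrix.det_blockDiagonal]
    exact Finset.prod_ne_zero_iff.2 fun _ _ => hε
  set X := (PSub (2 * p) p × UnitIdx k m) ⊕
    ((PSub (2 * p + 1) (p + 1) × Fin (p + 1)) × LOIdx k m p) with hX
  let e : Fin (Fintype.card X) ≃ X := (Fintype.equivFin X).symm
  have hdet' : (M.submatrix (rowSel k m p ∘ e) (colSel k m p ε ∘ e)).det ≠ 0 := by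
    rw [show M.submatrix (rowSel k m p ∘ e) (colSel k m p ε ∘ e) =
        (M.submatrix (rowSel k m p) (colSel k m p ε)).submatrix e e from rfl,
      Matrix.det_submatrix_equiv_self]
    exact hdet
  have hk := Matrix.le_rank_of_isUnit_det_submatrix _ (rowSel k m p ∘ e) (colSel k m p ε ∘ e)
    (isUnit_iff_ne_zero.2 hdet')
  have h2 := LandsbergOttaviani2015_thm21_algBorderRank p (loProj K k p c).mulVecLin
    (matMulDirectSum K k m k)
  have h12 := hk.trans h2
  -- counting
  have hcardX : Fintype.card X = (2 * p).choose p * Fintype.card (UnitIdx k m) +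
      (2 * p + 1).choose (p + 1) * (p + 1) * Fintype.card (LOIdx k m p) := by
    simp only [hX, Fintype.card_sum, Fintype.card_prod, card_PSub, Fintype.card_fin]
  have hid : (2 * p + 1).choose (p + 1) * (p + 1) = (2 * p + 1) * (2 * p).choose p :=
    (Nat.add_one_mul_choose_eq (2 * p) p).symm
  have hpos : 0 < (2 * p).choose p := Nat.choose_pos (by omega)
  rw [← card_unitIdx, ← card_loIdx]
  refine Nat.le_of_mul_le_mul_left ?_ hpos
  calc (2 * p).choose p * (Fintype.card (UnitIdx k m) + (2 * p + 1) * Fintype.card (LOIdx k m p))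
      = (2 * p).choose p * Fintype.card (UnitIdx k m) +
          (2 * p + 1).choose (p + 1) * (p + 1) * Fintype.card (LOIdx k m p) := by rw [hid]; ring
    _ = Fintype.card X := hcardX.symm
    _ ≤ _ := h12

/-- **The Landsberg–Ottaviani floor of a direct sum, over EVERY field**:
`∑_{kᵢ=1} mᵢ + (2p+1)·∑_{kᵢ=p+1} mᵢ ≤ R̲(⊕ᵢ ⟨kᵢ,mᵢ,kᵢ⟩)` (`p ≥ 1`) — nodes `X^j` in `K(X)` and
`R̲_{K(X)} ≤ R̲_K`. [cite: LandsbergOttaviani2015, Thm 1.1] [cite: BurgisserClausenShokrollahi1997, (15.26)] -/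
theorem lo_floor (k m : Fin q → ℕ) (p : ℕ) (hp : 1 ≤ p) :
    (∑ i ∈ univ.filter (fun i => k i = 1), m i) +
        (2 * p + 1) * ∑ i ∈ univ.filter (fun i => k i = p + 1), m i ≤
      algBorderRank (matMulDirectSum K k m k) := by
  classical
  let Lf := FractionRing K[X]
  let f : K →+* Lf := (algebraMap K[X] Lf).comp Polynomial.C
  have hmap : algBorderRank (matMulDirectSum Lf k m k) ≤ algBorderRank (matMulDirectSum K k m k) := by
    rw [← matMulDirectSum_map K f k m k]
    exact algBorderRank_map_le f _
  refine le_trans ?_ hmap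
  set x : Lf := algebraMap K[X] Lf Polynomial.X with hx
  have hc : Function.Injective (fun j : Fin (2 * p + 1) => x ^ (j : ℕ)) := by
    intro i j h
    apply Fin.ext
    simp only at h
    rw [hx, ← map_pow, ← map_pow] at h
    have h' := IsFractionRing.injective K[X] Lf h
    have := congrArg Polynomial.natDegree h'
    rwa [Polynomial.natDegree_X_pow, Polynomial.natDegree_X_pow] at this
  exact lo_floor_of_nodes Lf k m p hp (fun j => x ^ (j : ℕ)) hc

end Summit.MatrixMultiplication.MatrixMultiplication.Theorems.FarEdgeDescentKoszulFloor

end
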